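import Mathlib
import Summits.ValiantsHypothesis.ValiantsHypothesis.Theses.FeketeSOS

/-!
# Sketch — crux FeketeSOSHard (stmt-ValiantsHypothesis-3996), crux-ideate round 1, ideator 2

First lemmas for two idea cards:
* `EulerMultiplicityTau` — additive Hajós / char-`p` Koiran–Skomra at the Euler place.
* `WittZeroCarry` — depth-one bad reduction: Teichmüller digits of antipodal pairs carry nothing.
Nothing here is proved; every declaration is a `Prop` (or data) and the file must elaborate.
-/

open Polynomial
open scoped BigOperators

namespace Summit.ValiantsHypothesis.ValiantsHypothesis.Cruxes.FeketeSOSHard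

/-- The Fekete polynomial `F_p = ∑_{m<p} (m|p) X^m` with coefficients cast into `R`
(the crux inlines the case `R = ℂ`). -/
noncomputable def fekete (R : Type*) [Ring R] (p : ℕ) [Fact p.Prime] : R[X] :=
  ∑ m ∈ Finset.range p, C (((legendreSym p m : ℤ)) : R) * X ^ m

/-- Support-sum of a family of `r` pairs `(A_j, B_j)`. -/
noncomputable def pairSparsity {k : Type*} [Semiring k] {r : ℕ} (A B : Fin r → k[X]) : ℕ :=
  ∑ j, ((A j).support.card + (B j).support.card)

namespace EulerMultiplicityTau

/-- Euler's criterion in polynomial form (Mináč–Nguyen–Tân 2023, Prop. 5.1; re-proved by the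
sibling line on FeketeNoSparseSplit): in characteristic `p` (odd), `(X-1)^{(p-1)/2} ∥ F̄_p`. -/
def FeketeModPOrder : Prop :=
  ∀ (k : Type) [Field k] (p : ℕ) [Fact p.Prime] [CharP k p], p ≠ 2 →
    (X - 1 : k[X]) ^ ((p - 1) / 2) ∣ fekete k p ∧ ¬ (X - 1 : k[X]) ^ ((p - 1) / 2 + 1) ∣ fekete k p

/-- **Additive Hajós / char-`p` Koiran–Skomra with constant `C` (conjecture OS_C).**
A cyclic sum of `r` products of polynomials of degree `< p` over a field of characteristic `p`
that is nonzero in `k[X]/(X^p - 1)` vanishes at `X = 1` to order at most `C ·` support-sum.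
(`r = 1` is Hajós / the repeated-root MDS bound with `C = 1`; trivial bound is quadratic.) -/
def OrdSparsitySum (C : ℕ) : Prop :=
  ∀ (k : Type) [Field k] (p : ℕ) [Fact p.Prime] [CharP k p] (r : ℕ) (A B : Fin r → k[X]) (M : ℕ),
    (∀ j, (A j).natDegree < p ∧ (B j).natDegree < p) →
    ¬ ((X : k[X]) ^ p - 1 ∣ ∑ j, A j * B j) →
    (X - 1 : k[X]) ^ M ∣ ∑ j, A j * B j →
    M ≤ C * pairSparsity A B

/-- Weak (exponent-gain) form of OS: order ≤ `r^a · T^2 / T^η`-type bound, stated with natural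
exponents `num/den < 2`: `M^den ≤ C · r^a · T^num` with `num < 2·den`. Any instance with
`num/den < 2` already gives the crux's exponent gain in the good-reduction case. -/
def OrdSparsitySumWeak (C a num den : ℕ) : Prop :=
  num < 2 * den ∧
  ∀ (k : Type) [Field k] (p : ℕ) [Fact p.Prime] [CharP k p] (r : ℕ) (A B : Fin r → k[X]) (M : ℕ),
    (∀ j, (A j).natDegree < p ∧ (B j).natDegree < p) →
    ¬ ((X : k[X]) ^ p - 1 ∣ ∑ j, A j * B j) →
    (X - 1 : k[X]) ^ M ∣ ∑ j, A j * B j →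
    M ^ den ≤ C * r ^ a * (pairSparsity A B) ^ num

/-- The good-reduction Fekete bound (C⁺₁, characteristic-`p` side): any cyclic representation of
`F̄_p` as a sum of `r` sparse products over a field of characteristic `p` has support-sum
`≥ (p-1)/(2C)`. -/
def GoodReductionBound (C : ℕ) : Prop :=
  ∀ (k : Type) [Field k] (p : ℕ) [Fact p.Prime] [CharP k p], p ≠ 2 →
    ∀ (r : ℕ) (A B : Fin r → k[X]),
    (∀ j, (A j).natDegree < p ∧ (B j).natDegree < p) →
    ((X : k[X]) ^ p - 1 ∣ (∑ j, A j * B j) - fekete k p) →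
    (p - 1) / 2 ≤ C * pairSparsity A B

/-- First lemma of the line (provable now, three steps: `(X-1)^m ∣ X^p-1 = (X-1)^p`,
`F̄_p ≠ 0` has degree `< p`, apply OS). -/
def Composition (C : ℕ) : Prop :=
  FeketeModPOrder → OrdSparsitySum C → GoodReductionBound C

/-- A complex weighted-SOS representation has **good reduction at `p`** if all its coefficients lie
in a subring of `ℂ` admitting a ring map to a field of characteristic `p` (e.g. a valuation ring
of `ℂ` above `p` containing them; no such map exists on all of `ℂ`). -/
def HasGoodReduction (p : ℕ) {s : ℕ} (c : Fin s → ℂ) (g : Fin s → ℂ[X]) : Prop :=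
  ∃ (O : Subring ℂ) (k : Type) (_ : Field k) (_ : CharP k p) (_ : O →+* k),
    (∀ i, c i ∈ O) ∧ (∀ i n, (g i).coeff n ∈ O)

/-- C⁺₁ over `ℂ`: FeketeSOSHard restricted to representations of good reduction, with a LINEAR
bound and no restriction on the number of squares. -/
def GoodReductionFeketeSOS : Prop :=
  ∃ C : ℕ, 0 < C ∧ ∀ (p : ℕ) [Fact p.Prime], p ≠ 2 →
    ∀ (s : ℕ) (c : Fin s → ℂ) (g : Fin s → ℂ[X]),
      HasGoodReduction p c g →
      (∑ i, Polynomial.C (c i) * g i ^ 2) = fekete ℂ p →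
      (p - 1) / 2 ≤ C * ∑ i, (g i).support.card

/-- The complementary branch (bad reduction at every place above `p`), to be closed by the
flat-closure transfer (OS⁺) or by the Witt zero-carry line; stated here only as the case split. -/
def BadReductionFeketeSOS : Prop :=
  ∃ δ : ℝ, 0 < δ ∧ ∃ p₀ : ℕ, ∀ (p : ℕ) [Fact p.Prime], p₀ ≤ p →
    ∀ (s : ℕ) (c : Fin s → ℂ) (g : Fin s → ℂ[X]), (s : ℝ) ≤ (p : ℝ) ^ δ →
      ¬ HasGoodReduction p c g →
      (∀ i, (g i).natDegree ≤ p ^ 2) →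
      (∑ i, Polynomial.C (c i) * g i ^ 2) = fekete ℂ p →
      (p : ℝ) ^ (1 / 2 + δ) ≤ ∑ i, ((g i).support.card : ℝ)

/-- Shape of the eventual skeleton: the two branches give the crux (δ = min(δ_bad, 1/4)). -/
def CruxOfBranches : Prop :=
  GoodReductionFeketeSOS → BadReductionFeketeSOS →
    Summit.ValiantsHypothesis.ValiantsHypothesis.Theses.FeketeSOS.FeketeSOSHard

/-- Transfer target (OS⁺, "integer distinguisher" form): for every cheap support pattern there is an
integer polynomial relation satisfied by the coefficient vectors of ALL complex sums of `r` products
on that pattern whose reduction mod `p` does not vanish at the Euler vector `(n^{(p-1)/2})_{n<p}`.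
Patterns are lists of support sets; `coeffVec` packages `n ↦ coeff`. -/
def FlatClosureSeparation : Prop :=
  ∃ δ : ℝ, 0 < δ ∧ ∃ p₀ : ℕ, ∀ (p : ℕ) [Fact p.Prime], p₀ ≤ p →
    ∀ (r : ℕ) (S S' : Fin r → Finset ℕ),
      (r : ℝ) ≤ (p : ℝ) ^ δ → ((∑ j, ((S j).card + (S' j).card) : ℕ) : ℝ) < (p : ℝ) ^ (1 / 2 + δ) →
      (∀ j, ∀ u ∈ S j, u < p) → (∀ j, ∀ v ∈ S' j, v < p) →
      ∃ P : MvPolynomial (Fin (2 * p)) ℤ,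
        (∀ (A B : Fin r → ℂ[X]), (∀ j, (A j).support ⊆ S j) → (∀ j, (B j).support ⊆ S' j) →
            MvPolynomial.aeval (fun n : Fin (2 * p) => (∑ j, A j * B j).coeff n) P = 0) ∧
        MvPolynomial.eval (fun n : Fin (2 * p) => ((legendreSym p n : ℤ) : ZMod p))
            (MvPolynomial.map (Int.castRingHom (ZMod p)) P) ≠ 0

end EulerMultiplicityTau

namespace WittZeroCarry

/-- Coefficientwise Teichmüller lift of a polynomial over a ring of characteristic `p` into Witt
vectors (supports are preserved: the lift of a `t`-sparse polynomial is `t`-sparse). -/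
noncomputable def teichLift (p : ℕ) [Fact p.Prime] {k : Type*} [CommRing k] (W : k[X]) :
    (WittVector p k)[X] :=
  ∑ n ∈ W.support, C (WittVector.teichmuller p (W.coeff n)) * X ^ n

/-- Number of digit-products `a_{j,u} b_{j,v}` (over all pairs `j`) landing on the exponent `n`. -/
noncomputable def repCount {k : Type*} [Semiring k] {r : ℕ} (A B : Fin r → k[X]) (n : ℕ) : ℕ :=
  ∑ j, (((A j).support ×ˢ (B j).support).filter (fun uv => uv.1 + uv.2 = n)).card

/-- Antipodal Teichmüller digits cancel exactly (p odd): `[−z] = −[z]`. -/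
def TeichmullerNeg : Prop :=
  ∀ (p : ℕ) [Fact p.Prime] (k : Type) [CommRing k] [CharP k p], p ≠ 2 →
    ∀ z : k, WittVector.teichmuller p (-z) = -WittVector.teichmuller p z

/-- **Zero-carry lemma.** A top-layer syzygy `Σ_j Ā_j B̄_j = 0` over `k` in which every exponent
receives at most two digit-products lifts to an EXACT syzygy of the Teichmüller lifts over `𝕎 k`:
no carry into the next `p`-adic layer. (With three or more colliding digit-products the first Witt
addition polynomial — a nonzero degree-`p` form — is the carry obstruction.) -/
def ZeroCarry : Prop :=
  ∀ (p : ℕ) [Fact p.Prime] (k : Type) [CommRing k] [IsDomain k] [CharP k p], p ≠ 2 →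
    ∀ (r : ℕ) (A B : Fin r → k[X]),
    (∀ n, repCount A B n ≤ 2) → ∑ j, A j * B j = 0 →
    ∑ j, teichLift p (A j) * teichLift p (B j) = 0

/-- Depth-one clean layer (what the line uses): under the hypotheses of `ZeroCarry`, the next
`p`-adic layer of `Σ_j A_j B_j` (with arbitrary higher digits `A'_j, B'_j`) is an honest sum of `2r`
sparse products on the same supports, up to `p²`. -/
def DepthOneClean : Prop :=
  ∀ (p : ℕ) [Fact p.Prime] (k : Type) [CommRing k] [IsDomain k] [CharP k p], p ≠ 2 →
    ∀ (r : ℕ) (A B : Fin r → k[X]) (A' B' : Fin r → (WittVector p k)[X]),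
    (∀ n, repCount A B n ≤ 2) → ∑ j, A j * B j = 0 →
    ∃ R : (WittVector p k)[X],
      ∑ j, (teichLift p (A j) + C (p : WittVector p k) * A' j) *
            (teichLift p (B j) + C (p : WittVector p k) * B' j)
        = C (p : WittVector p k) * ∑ j, (teichLift p (A j) * B' j + A' j * teichLift p (B j))
          + C ((p : WittVector p k) ^ 2) * R

/-- Conjecture (syzygy multiplicity): a syzygy on a CHEAP COVERING pattern is telescoping — every
exponent carries at most two digit-products (tiling syzygies `(x^a-1)σ_b(x^a) = (x^b-1)σ_a(x^b)`
are the model: each exponent gets exactly `{z, -z}`). Stated for the cyclic group ring, degrees `< p`. -/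
def SyzygyMultiplicity : Prop :=
  ∃ δ : ℝ, 0 < δ ∧ ∃ p₀ : ℕ, ∀ (p : ℕ) [Fact p.Prime], p₀ ≤ p →
    ∀ (k : Type) [Field k] [CharP k p] (r : ℕ) (A B : Fin r → k[X]),
    (r : ℝ) ≤ (p : ℝ) ^ δ → ((pairSparsity A B : ℕ) : ℝ) < (p : ℝ) ^ (1 / 2 + δ) →
    (∀ j, (A j).natDegree < p ∧ (B j).natDegree < p) → (∀ j, A j * B j ≠ 0) →
    (∀ n, 1 ≤ n → n < p → ∃ j, ∃ u ∈ (A j).support, ∃ v ∈ (B j).support, (u + v) % p = n) →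
    ((X : k[X]) ^ p - 1 ∣ ∑ j, A j * B j) →
    ∀ n, repCount A B n ≤ 2

end WittZeroCarry

end Summit.ValiantsHypothesis.ValiantsHypothesis.Cruxes.FeketeSOSHard
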